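import Literature.NumberTheory.ComplexMultiplication.EllipticUnits.ImaginaryQuadraticMainConjectureAllPrimes
import Literature.NumberTheory.EllipticCurves.IwasawaAlgebraSemilinearCharIdealProofs
import Summits.BirchSwinnertonDyer.BirchSwinnertonDyer.Theorems.ThetaPartnerAtTwoSignedKatoUpToAtTwoSemilinearTransport
import HarnessLib

/-!
# Route `SignedLowerHalves`, crux L `SmallImageLowerHalfBothSigns` (stmt-BirchSwinnertonDyer-23599), line `rtt_w3` v14 — E2, road-D frame, row «D-tw-alg» (LEAD):
# `Thm52Shape`, finite generation, torsion and the unit condition on `N𝔞 − σ_𝔞` are INVARIANT UNDER TRANSPORT of a `ZetaSkeleton` along a ring isomorphism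

WHY (RULING «U», HOME STATUS 2026-08-30T18:27Z; BRIEF-E2 rev 5 `Lines/rtt_w3-BRIEF-E2-g11.md`). The v15 consumer `SmallImageRttCharRoad.charRoad_E2_of_roadD_junction_of_isUnit_nsub`
(p782277) needs honda's two-variable skeleton `D` with `D.Thm52Shape` FOR THE INFINITE-ORDER CHARACTER `θ* = θ_ψ⁻¹` (so that the specialisation `sp¹` into
`B = 𝐇¹_{Iw}(K_∞, 𝒪(1)(θ*))` and the Poitou–Tate map `j₀` are `Λ_𝒪`-linear for the untwisted structures), while the FACT `cor53_thm52ShapeO` ([JLK] Cor. 5.3)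
gives `Thm52Shape` for the FINITE-ORDER part `χ₀` of `θ*` only. The passage `D(χ₀) ↦ D(θ*)` is the transport along the twisting automorphism `Tw_η` of
`Λ_{𝒪,2}` (`T_i ↦ η(γ_i)(1+T_i) − 1`, `η = θ*·χ₀⁻¹` a character of `Gal(K̃_∞/K)`): cohomologically (row «D-tw-coh», honda) an additive isomorphism of the
carriers, `Λ_{𝒪,2}`-SEMILINEAR along `Tw_η`, matching the zeta elements. THIS FILE is the module-theoretic half (row «D-tw-alg»): for two skeletons `D`
(over `R`) and `D'` (over `S`), a ring isomorphism `σ : R ≃+* S` and additive equivalences `e₀, e₁, e₂` of the carriers, `σ`-semilinear, with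
`e₁ (D.aZeta a) = D'.aZeta a`, we prove `D.Thm52Shape → D'.Thm52Shape` (and transport `Module.Finite`, torsion, `char`), using the tree's
`Module.charIdeal_eq_map_of_semilinearEquiv` / `lengthAt_eq_of_semilinearEquiv` (`char_S(N) = σ(char_R(M))`) and Mathlib's `lift_rank_eq_of_equiv_equiv`.

* `toSemilinearEquiv` (local packaging, no `def`: built inline) — an additive equivalence with `e (r • m) = σ r • e m` as `M ≃ₛₗ[σ] N`;
* `moduleFinite_of_semilinearEquiv`, `rank_eq_one_of_semilinearEquiv` (torsion / non-zero-divisors: tree `SignedKatoOffTwo.SemilinearTransport.isTorsion_of_semilinear`);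
* `Z_eq_map_of_aZeta_eq` — `D'.Z = (D.Z).map e₁`; `quotientZ_addEquiv…` — the induced `σ`-semilinear equivalence `H1 ⧸ D.Z ≃+ H1' ⧸ D'.Z`;
* ★★ `thm52Shape_of_semilinearEquiv` — `D.Thm52Shape → D'.Thm52Shape`;
* ★ `isUnit_iff_of_sub_mem_maximalIdeal` — for ring maps `ψ₁ ψ₂ : R → 𝒪` into a local ring with `ψ₁ x − ψ₂ x ∈ 𝔪`: `IsUnit (ψ₁ x) ↔ IsUnit (ψ₂ x)`
  (the unit condition `IsUnit (φ (D.nsub 𝔞))` read on double constant terms survives `Tw_η`, whose constant terms `η(γ_i) − 1` lie in `𝔪_𝒪`).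

THEOREMS ONLY (`--supports stmt-BirchSwinnertonDyer-23599` helper); closes nothing; crux L, crux M, E2 and BSD remain OPEN and are proved for NO curve by any of this.
[cite: JohnsonLeungKings2011, Thm. 5.2, Cor. 5.3 (arXiv p0014:L114–138, p0015:L1–20)] [cite: BourbakiAC5to7, Ch. VII §4.4–4.5] [cite: GreenbergLNM1716, §1 p. 60 (twisting and char)]
[cite: Rubin2000, Ch. VI §1–§2 (twisting by characters of Γ)]
-/

set_option autoImplicit false
-- the Theorems namespace of this sub repeats the summit name by design (D-0017 nested layout)
set_option linter.dupNamespace false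

noncomputable section

open Literature.NumberTheory.ComplexMultiplication.EllipticUnits.JohnsonLeungKings2011
open Literature.NumberTheory.EllipticCurves Literature.NumberTheory.EllipticCurves.Module

namespace Summit.BirchSwinnertonDyer.BirchSwinnertonDyer.Theorems.SmallImageRttD2LamSpec

universe u u' v v' w

section Transport

variable {R : Type u} [CommRing R] {S : Type u'} [CommRing S] (σ : R ≃+* S)

/-! ## §1 Semilinear bookkeeping -/

variable {M : Type v} [AddCommGroup M] [Module R M] {N : Type v'} [AddCommGroup N] [Module S N]
  (e : M ≃+ N) (he : ∀ (r : R) (m : M), e (r • m) = σ r • e m)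

include he in
/-- **Finite generation is transported** along a `σ`-semilinear additive equivalence. [folklore] -/
theorem moduleFinite_of_semilinearEquiv [Module.Finite R M] : Module.Finite S N := by
  classical
  haveI : RingHomInvPair (σ : R →+* S) (σ.symm : S →+* R) := RingHomInvPair.of_ringEquiv σ
  haveI : RingHomInvPair (σ.symm : S →+* R) (σ : R →+* S) := RingHomInvPair.symm (σ : R →+* S) (σ.symm : S →+* R)
  let e' : M ≃ₛₗ[(σ : R →+* S)] N := { e with map_smul' := he }
  obtain ⟨s, hs⟩ := Module.Finite.fg_top (R := R) (M := M)
  have h2 : Submodule.span S ((e' : M →ₛₗ[(σ : R →+* S)] N) '' (↑s : Set M)) = ⊤ := by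
    rw [← Submodule.map_span, hs, Submodule.map_top, LinearEquiv.range]
  refine ⟨⟨s.image e, ?_⟩⟩
  have hfun : (e : M → N) = ((e' : M →ₛₗ[(σ : R →+* S)] N) : M → N) := rfl
  rw [Finset.coe_image, hfun]
  exact h2

include he in
/-- **`rank_S N = 1` from `rank_R M = 1`** along a `σ`-semilinear additive equivalence (Mathlib `lift_rank_eq_of_equiv_equiv`). [folklore] -/
theorem rank_eq_one_of_semilinearEquiv (h : Module.rank R M = 1) : Module.rank S N = 1 := by
  have hl := lift_rank_eq_of_equiv_equiv (σ : R → S) e σ.bijective he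
  rw [h, Cardinal.lift_one] at hl
  exact Cardinal.lift_eq_one.mp hl.symm

end Transport

/-! ## §2 Skeleton transport -/

section Skeleton

variable {R : Type u} [CommRing R] {S : Type u'} [CommRing S] (σ : R ≃+* S)
  {A : Type w} {H0 H1 H2 : Type v} [AddCommGroup H0] [Module R H0] [AddCommGroup H1] [Module R H1] [AddCommGroup H2] [Module R H2]
  {H0' H1' H2' : Type v'} [AddCommGroup H0'] [Module S H0'] [AddCommGroup H1'] [Module S H1'] [AddCommGroup H2'] [Module S H2']
  (D : ZetaSkeleton R A H0 H1 H2) (D' : ZetaSkeleton S A H0' H1' H2')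
  (e₁ : H1 ≃+ H1') (he₁ : ∀ (r : R) (m : H1), e₁ (r • m) = σ r • e₁ m)
  (haZ : ∀ a : A, e₁ (D.aZeta a) = D'.aZeta a)

include he₁ haZ in
/-- **`D'.Z = e₁(D.Z)`** (as additive subgroups): the zeta span is transported when the zeta families match. [cite: JohnsonLeungKings2011, §5.2] -/
theorem Z_toAddSubgroup_eq_map : D'.Z.toAddSubgroup = D.Z.toAddSubgroup.map (e₁ : H1 →+ H1') := by
  haveI : RingHomInvPair (σ : R →+* S) (σ.symm : S →+* R) := RingHomInvPair.of_ringEquiv σ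
  haveI : RingHomInvPair (σ.symm : S →+* R) (σ : R →+* S) := RingHomInvPair.symm (σ : R →+* S) (σ.symm : S →+* R)
  let e' : H1 ≃ₛₗ[(σ : R →+* S)] H1' := { e₁ with map_smul' := he₁ }
  have hrange : Set.range D'.aZeta = e' '' Set.range D.aZeta := by
    ext y
    constructor
    · rintro ⟨a, rfl⟩
      exact ⟨D.aZeta a, ⟨a, rfl⟩, haZ a⟩
    · rintro ⟨_, ⟨a, rfl⟩, rfl⟩
      exact ⟨a, (haZ a).symm⟩
  have hZ : D'.Z = (D.Z).map (e' : H1 →ₛₗ[(σ : R →+* S)] H1') := by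
    change Submodule.span S (Set.range D'.aZeta) = (Submodule.span R (Set.range D.aZeta)).map _
    rw [Submodule.map_span, hrange]
    rfl
  rw [hZ]
  ext x
  change x ∈ (D.Z).map (e' : H1 →ₛₗ[(σ : R →+* S)] H1') ↔ x ∈ D.Z.toAddSubgroup.map (e₁ : H1 →+ H1')
  rw [Submodule.mem_map, AddSubgroup.mem_map]
  constructor
  · rintro ⟨y, hy, rfl⟩
    exact ⟨y, hy, rfl⟩
  · rintro ⟨y, hy, rfl⟩
    exact ⟨y, hy, rfl⟩

include he₁ haZ in
/-- **The `σ`-semilinear additive equivalence `H1 ⧸ D.Z ≃+ H1' ⧸ D'.Z`** induced by `e₁`: existence with its defining square and semilinearity.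
[cite: JohnsonLeungKings2011, §5.2] [folklore] -/
theorem exists_quotientZ_addEquiv :
    ∃ ē : (H1 ⧸ D.Z) ≃+ (H1' ⧸ D'.Z), (∀ x : H1, ē (Submodule.Quotient.mk x) = Submodule.Quotient.mk (e₁ x)) ∧
      ∀ (r : R) (x : H1 ⧸ D.Z), ē (r • x) = σ r • ē x := by
  have hmap := Z_toAddSubgroup_eq_map σ D D' e₁ he₁ haZ
  let ē : (H1 ⧸ D.Z) ≃+ (H1' ⧸ D'.Z) :=
    QuotientAddGroup.congr D.Z.toAddSubgroup D'.Z.toAddSubgroup e₁ hmap.symm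
  have hē : ∀ x : H1, ē (Submodule.Quotient.mk x) = Submodule.Quotient.mk (e₁ x) := fun x ↦ rfl
  refine ⟨ē, hē, fun r x ↦ ?_⟩
  obtain ⟨y, rfl⟩ := Submodule.Quotient.mk_surjective _ x
  rw [← Submodule.Quotient.mk_smul, hē, hē, he₁, Submodule.Quotient.mk_smul]

variable (e₀ : H0 ≃+ H0') (e₂ : H2 ≃+ H2') (he₂ : ∀ (r : R) (m : H2), e₂ (r • m) = σ r • e₂ m)

include e₀ he₁ haZ he₂ in
/-- ★★ **`Thm52Shape` is transported along a ring isomorphism.** Skeletons `D` over `R` and `D'` over `S`, `σ : R ≃+* S`, additive equivalences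
`e₀ : H0 ≃+ H0'`, `e₁ : H1 ≃+ H1'`, `e₂ : H2 ≃+ H2'` with `e₁, e₂` `σ`-semilinear and `e₁ (D.aZeta a) = D'.aZeta a`: then `D.Thm52Shape → D'.Thm52Shape`
(`H0' = 0`; `rank_S H1' = 1`; `H1'/Z'`, `H2'` torsion; `char_S(H1'/Z') = σ(char_R(H1/Z)) = σ(char_R H2) = char_S H2'`). In E2 (RULING «U»): `R = S = Λ_{𝒪,2}`,
`σ = Tw_η`, `D = ` honda's skeleton for the finite-order `χ₀` (FACT `cor53_thm52ShapeO`), `D'` = the skeleton for `θ* = θ_ψ⁻¹`.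
[cite: JohnsonLeungKings2011, Thm. 5.2 (arXiv p0014:L114–138)] [cite: GreenbergLNM1716, §1 p. 60] [cite: Rubin2000, Ch. VI §1–§2] -/
theorem thm52Shape_of_semilinearEquiv (h : D.Thm52Shape) : D'.Thm52Shape := by
  obtain ⟨⟨h0, hrank, htorsA, htorsB⟩, hchar⟩ := h
  obtain ⟨ē, -, hē⟩ := exists_quotientZ_addEquiv σ D D' e₁ he₁ haZ
  refine ⟨⟨?_, ?_, ?_, ?_⟩, ?_⟩
  · exact ⟨fun a b ↦ e₀.symm.injective (Subsingleton.elim _ _)⟩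
  · exact rank_eq_one_of_semilinearEquiv σ e₁ he₁ hrank
  · exact SignedKatoOffTwo.SemilinearTransport.isTorsion_of_semilinear σ ē hē htorsA
  · exact SignedKatoOffTwo.SemilinearTransport.isTorsion_of_semilinear σ e₂ he₂ htorsB
  · change charIdeal S (H1' ⧸ D'.Z) = charIdeal S H2'
    rw [charIdeal_eq_map_of_semilinearEquiv σ ē hē, charIdeal_eq_map_of_semilinearEquiv σ e₂ he₂]
    exact congrArg _ hchar

include he₁ he₂ in
/-- **Finite generation of the carriers is transported** (the consumer's `[Module.Finite R H1] [Module.Finite R H2]`). [folklore] -/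
theorem moduleFinite_pair_of_semilinearEquiv [Module.Finite R H1] [Module.Finite R H2] : Module.Finite S H1' ∧ Module.Finite S H2' :=
  ⟨moduleFinite_of_semilinearEquiv σ e₁ he₁, moduleFinite_of_semilinearEquiv σ e₂ he₂⟩

end Skeleton

/-! ## §3 The unit condition on `N𝔞 − σ_𝔞` survives the twist -/

/-- ★ **Two ring maps into a local ring that agree modulo `𝔪` see the same units.** For `ψ₁ ψ₂ : R →+* 𝒪`, `𝒪` local, with `ψ₁ x − ψ₂ x ∈ 𝔪_𝒪` for all `x`:
`IsUnit (ψ₁ x) ↔ IsUnit (ψ₂ x)`. In E2: `ψ₁ = cc ∘ cc` (double constant term of `Λ_{𝒪,2}`), `ψ₂ = cc ∘ cc ∘ Tw_η` (evaluation at `(η(γ₁) − 1, η(γ₂) − 1) ∈ 𝔪²`), so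
`IsUnit (φ₀ (Tw_η (nsub 𝔞))) ↔ IsUnit (φ₀ (nsub 𝔞))` through LEAD g10's `isUnit_map_iff_isUnit_constantCoeff_constantCoeff`. [folklore] -/
theorem isUnit_iff_of_sub_mem_maximalIdeal {R : Type u} [CommRing R] {O : Type v} [CommRing O] [IsLocalRing O] (ψ₁ ψ₂ : R →+* O)
    (hψ : ∀ x : R, ψ₁ x - ψ₂ x ∈ IsLocalRing.maximalIdeal O) (x : R) : IsUnit (ψ₁ x) ↔ IsUnit (ψ₂ x) := by
  constructor
  · intro h1
    by_contra h2
    have hm : ψ₂ x ∈ IsLocalRing.maximalIdeal O := (IsLocalRing.mem_maximalIdeal _).mpr h2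
    have : ψ₁ x ∈ IsLocalRing.maximalIdeal O := by
      have := Ideal.add_mem _ (hψ x) hm
      rwa [sub_add_cancel] at this
    exact (IsLocalRing.mem_maximalIdeal _).mp this h1
  · intro h2
    by_contra h1
    have hm : ψ₁ x ∈ IsLocalRing.maximalIdeal O := (IsLocalRing.mem_maximalIdeal _).mpr h1
    have : ψ₂ x ∈ IsLocalRing.maximalIdeal O := by
      have := Ideal.sub_mem _ hm (hψ x)
      rwa [sub_sub_cancel] at this
    exact (IsLocalRing.mem_maximalIdeal _).mp this h2

end Summit.BirchSwinnertonDyer.BirchSwinnertonDyer.Theorems.SmallImageRttD2LamSpec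

end
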